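import Summits.BirchSwinnertonDyer.BirchSwinnertonDyer.Theorems.TameQuarticManinParityTprimeHeegnerUpperOfManinUnitMonoCarrier
import Summits.BirchSwinnertonDyer.BirchSwinnertonDyer.Theorems.Rank1ResidualJetModPCarrierEndFormsNoCV
import Summits.BirchSwinnertonDyer.BirchSwinnertonDyer.Theorems.Rank1ResidualJetModPSwapLevelRaisingLiterature
import Summits.BirchSwinnertonDyer.Rank1Residual.JET.CarrierEndFormsGross1991
import Literature.NumberTheory.EllipticCurves.ZywinaCMImageProofs
import HarnessLib

/-!
# Crux X₄ `TprimeHeegnerUpperOfManinUnit` (stmt-BirchSwinnertonDyer-23738; TQMP r4 / TQS r303), line `rows_of_manin_unit` v2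
# (3c59fc8b80b3), research stub Σ `stub_sigmaIrreducibleOptimalRows`: on the rows with `ρ̄_{E,3}` ONTO (v1's r₁
# `stub_ontoRowsOfManinUnit`) and ONE dominating Tamagawa-`3` carrier of ANY reduction type, Σ is PRINT — three NAMED Literature
# facts {Poitou–Tate, Gross 1991 §6 / [GZ86 III (3.1)] `E⁰` (Gross-scoped), Gross 1991 Prop. 3.7 (2)} and NO reading stub — by
# bsd-jet's mod-`p` Kolyvagin-prime-swap end form (`JET.jetchevDivisibilityCarrierNe_of_levelRaisingNoCV_modP`); hence r₁'s
# mono-carrier rows ⟸ PUB + three print facts + KT 19981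

HONEST FRAMING. Theorems only; helper file (`--supports stmt-BirchSwinnertonDyer-23738 --as helper`, leafhand `leafhand-bsd-tamequarticmaninpa-5`
g0, 2026-08-31); no definition, no named fact, no `sorry`; CONDITIONAL on every displayed input; nothing booked, no stub closed BY NAME, no
item closed, BSD proved for no curve. Companion of this seat's `…SigmaCarrierBlind` / `…SigmaMonoCarrierRows` (the IRREDUCIBLE face: Σ on
all mono-carrier rows ⟸ 20165's reading S2′ + three facts). WHY A SEPARATE ONTO FACE: cell bsd-wall's SOED column proved Jetchev's
max-form at `3 ∣ N` under `ρ̄₃` ONTO from print alone (`WildKolyvaginUpperAtThreeTowerFreeJetchevMaxModThree.jetchevMaxModThree_of_literature`,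
p606426, there under the class binder `ClassO6`): with a surjective image the McCallum Prop. 5.2 reading is replaced by the Kolyvagin-prime
SWAP / level raising at minimal depth (`JET.Swap.levelRaising_of_literature_modP` ⟸ {PT, E0, 3.7 (2)} — Gross 3.7 (2) in Gross's own
setting allows the Kolyvagin prime `2`), and the carrier end form `JET.jetchevDivisibilityCarrierNe_…_modP` is class-free and, like the
irreducible node, blind to the reduction type at the carrier `q ≠ p`. This file reads that into the (t′) column:

* §1 `pDiv_of_dvd_level_of_heegnerFrame_onto_of_threePrintFacts` — on a Heegner frame `(Dt, H.β, ι, P)` of a curve with `ρ̄_p` ONTO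
  (`p` odd; no reduction hypothesis at `p`), `d_K ∉ {−3, −4}`: `Koly.PDiv d p s` for `s ≤ ord_p c_q(E)` at ANY prime `q ∣ N_E`, `q ≠ p`,
  from {PT, E0, 3.7 (2)} ONLY.
* §2 `sigmaIrreducibleOptimalRows_monoCarrier_onto_of_threePrintFacts` — Σ's binders VERBATIM + «`ρ̄₃` onto» + the row clause «some prime
  `q ∣ N_E` has `ord₃ ∏ c_ℓ ≤ ord₃ c_q`» ⟹ Σ's conclusion, from the three print facts ONLY (carrier `q = 3`: `c₃ = 2` on (t′), p824349
  §1, so the depth is `0`).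
* §3 `tprime_upper_three_of_onto_carrier_of_threePrintFacts_of_lowerRankZero` — `Typed.MissingUpperBoundAt W 3` on such a row with a
  Manin-clean datum ⟸ PUB + three print facts + L₀.
* §4 `ontoRows_monoCarrier_of_pub_of_threePrintFacts_of_tameLowerHalfRankZero` — in v1's r₁ binders (`ρ̄₃` onto, VERBATIM) + row clause:
  ⟸ PUB + three print facts + KT 19981 BY NAME. So on the ONTO mono-carrier (t′) rows the whole upper half is PRINT ⊕ L₀.
ACCOUNTING for Σ (this seat, four files): mono-carrier ∧ onto ⟹ PRINT; mono-carrier ∧ irreducible-not-onto ⟹ S2′ (20165) + print;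
≥ 2 Tamagawa-`3` carriers ⟹ OPEN beyond `m_max` (Σ⁺ of `…SigmaResidual`; refined Kolyvagin `≥`, p826193).
References: [cite: Jetchev2008, Thm. 1.4 (p. 812), Prop. 4.9, Thm. 6.3] [cite: Cha2005, Thm. 3 and Thm. 7] [cite: GrossLMS1991, Prop. 3.7 (2), §6 p. 245]
[cite: McCallumLMS1991, §3, Prop. 4.4] [cite: GrossZagier1986, III (3.1), Thm. I.(6.3), (7.3)] [cite: MatarNekovar2019, Thm. 0.7 (p. 456), §0.11]
[cite: FriedbergHoffstein1995, Thm. B] [cite: Zywina2015, Prop. 1.14] [cite: SilvermanATAEC1994, IV.9.4 Steps 4 and 9] [cite: Kato2004Asterisque, Thm. 17.4].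
presearch (D-0021): `lean search 'jetchevMaxModThree|levelRaisingNoCV_modP'` → SOED p606426 (under `ClassO6`) and bsd-jet's class-free end forms;
no (t′)/TQMP instance in the tree. [corpus:arxiv-math_0703431 p. 3 Thm. 1.4]; galaxy «level raising|Kolyvagin prime» → Gross 1991 / BD only.
-/

-- D-0017: single-problem summit, so `Summit.BirchSwinnertonDyer.BirchSwinnertonDyer.…` repeats a namespace BY DESIGN.
set_option linter.dupNamespace false
set_option autoImplicit false

noncomputable section

open scoped Classical NumberField

open WeierstrassCurve IsDedekindDomain NumberField Literature Literature.NumberTheory.EllipticCurves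
  Literature.NumberTheory.EllipticCurves.ModularForms
  Literature.NumberTheory.EllipticCurves.Rank1Residual
  Literature.NumberTheory.EllipticCurves.Rank1Residual.Typed
  Literature.NumberTheory.GaloisCohomology
  Summit.BirchSwinnertonDyer.Rank1Residual
  Summit.BirchSwinnertonDyer.Rank1Residual.Additive
  Summit.BirchSwinnertonDyer.Rank1Residual.X11b
  Summit.BirchSwinnertonDyer.Rank1Residual.X11b.Three
  Summit.BirchSwinnertonDyer.BirchSwinnertonDyer.Theses
  Summit.BirchSwinnertonDyer.BirchSwinnertonDyer.Theorems

namespace Summit.BirchSwinnertonDyer.BirchSwinnertonDyer.Theorems.TprimeHeegnerUpperOfManinUnit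

/-! ## §1 The swap end form on a Heegner frame: `ρ̄_p` onto, carrier `q ≠ p` of any reduction type, print only -/

/-- **`p^s ∣ P_n` to depth `ord_p c_q(E)` on a Heegner frame of a curve with `ρ̄_p` ONTO, from THREE PRINT FACTS ONLY.** Data: `W/ℚ`
globally minimal with `ρ̄_{E,p}` surjective (`p` odd; hence non-CM — Zywina / Serre), `K` imaginary quadratic with `d_K ∉ {−3, −4}` and
Heegner for `N_E`, a datum `Dt` at level `N_E`, a Heegner datum `H`, `ι`, the Heegner point `P` of `Dt` (non-torsion), a prime `q ∣ N_E`
with `q ≠ p` (ANY reduction type at `q`) and `s ≤ ord_p c_q(E)`. NAMED FACTS: `hPT` Poitou–Tate (∀ K), `hF1` Gross 1991 §6 p. 245 /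
[GZ86 III (3.1)] (`Gross1991_heegnerPoint_sub_ratTorsion_mem_E0`, Gross-scoped), `h372` Gross 1991 Prop. 3.7 (2). Proof: level raising
at minimal depth from the three facts (`JET.Swap.levelRaising_of_literature_modP`), the receptacle schema from `hF1`
(`JET.forall_hGZ_of_Gross1991`), the conductor-`1` datum with bottom point `P`, then bsd-jet's mod-`p` carrier end form
`JET.jetchevDivisibilityCarrierNe_of_levelRaisingNoCV_modP`. CONDITIONAL; nothing asserted.
[cite: Jetchev2008, Thm. 1.4 (p. 812), Thm. 6.3] [cite: Cha2005, Thm. 3, Thm. 7] [cite: GrossLMS1991, Prop. 3.7 (2), §6 p. 245] [cite: Zywina2015, Prop. 1.14] -/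
theorem pDiv_of_dvd_level_of_heegnerFrame_onto_of_threePrintFacts
    (hPT : ∀ (K : Type) [Field K] [NumberField K], poitouTate_selmerStructure_duality_conj K)
    (hF1 : Gross1991_heegnerPoint_sub_ratTorsion_mem_E0) (h372 : GrossLMS1991.prop37_2_frobeniusCongruence)
    (W : WeierstrassCurve ℚ) [W.IsElliptic] [W.IsGloballyMinimal] [NeZero (W.conductorNorm ℤ)]
    (K : Type) [Field K] [NumberField K] (hK : IsImaginaryQuadratic K)
    (h3 : NumberField.discr K ≠ -3) (h4 : NumberField.discr K ≠ -4)
    (hHN : SatisfiesHeegnerHypothesis (W.conductorNorm ℤ) K)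
    (p : ℕ) [Fact p.Prime] (hp2 : p ≠ 2) (hsurj : W.HasSurjectiveModNGaloisRep p)
    (Dt : ModularParametrizationData W (W.conductorNorm ℤ))
    (H : HeegnerDatum (W.conductorNorm ℤ) (NumberField.discr K)) (ι : K →+* ℂ) (P : (W.baseChange K).toAffine.Point)
    (hP : WeierstrassCurve.Affine.Point.map ι.toRatAlgHom P = heegnerPointComplex Dt H) (hnt : ¬ IsOfFinAddOrder P)
    (q : ℕ) [Fact q.Prime] (hqN : q ∣ W.conductorNorm ℤ) (hqp : q ≠ p)
    (s : ℕ) (hs : s ≤ padicValNat p ((W.baseChange ℚ_[q]).localTamagawaNumber ℤ_[q]))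
    (n : ℕ) (d : KolyvaginHeegnerData Dt H.β ι n) (hn : Squarefree n)
    (hℓ : ∀ ℓ ∈ n.primeFactors, Zhang2014.IsKolyvaginPrime (W.conductorNorm ℤ) W K p ℓ ∧
      s ≤ Zhang2014.kolyvaginIndex W p ℓ) :
    Koly.PDiv d p s := by
  -- non-CM from `ρ̄_p` onto
  have hcm : ¬ W.HasCM := fun hCM ↦
    W.not_hasSurjectiveModNGaloisRep_of_hasCM hCM (Fact.out : p.Prime) hp2 hsurj
  -- the conductor-`1` Kolyvagin–Heegner datum on the frame, with bottom point `P` (Darmon 3.6 / Shimura, proved)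
  obtain ⟨d₁⟩ := exists_kolyvaginHeegnerData_one
    (phi_heegnerTau_mem_singularModuliField_holds (W.conductorNorm ℤ) W K) hK Dt H.β ι H.dvd_sq_sub
  have hPd : d₁.toGeomPoints d₁.derivedPoint = toGeomPoints (W.baseChange K) P :=
    X11b.KolyvaginBottom.toGeomPoints_derivedPoint_one_eq
      (heegnerPointOfConductor_one_galoisConj_holds (W.conductorNorm ℤ) W K) hK hHN hP d₁ rfl
  have hy₁ : ¬ IsOfFinAddOrder d₁.derivedPoint := by
    intro hfin
    apply hnt
    have h1 : IsOfFinAddOrder (d₁.toGeomPoints d₁.derivedPoint) := d₁.toGeomPoints.isOfFinAddOrder hfin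
    rw [hPd] at h1
    exact (toGeomPoints_injective (W.baseChange K)).isOfFinAddOrder_iff.mp h1
  -- level raising from the three facts, the receptacle schema from `hF1`, then the mod-`p` carrier end form at `q ≠ p`
  exact JET.jetchevDivisibilityCarrierNe_of_levelRaisingNoCV_modP (JET.Swap.levelRaising_of_literature_modP hPT hF1 h372)
    h372 hPT (JET.forall_hGZ_of_Gross1991 hF1) W hcm K hK h3 h4 hHN p hp2 hsurj Dt H.β ι d₁ hy₁ q hqN hqp s hs n d hn hℓ

/-! ## §2 Σ on the ONTO mono-carrier (t′) rows: print only -/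

/-- **Σ ON THE MONO-CARRIER (t′) ROWS WITH `ρ̄₃` ONTO ⟸ THREE PRINT FACTS, nothing else.** The registered research stub
Σ = `stub_sigmaIrreducibleOptimalRows` (crux 23738), binders VERBATIM, with «`ρ̄_{E,3}` onto» (v1's r₁ binder) and the row clause
«some prime `q ∣ N_E` has `ord₃ ∏_ℓ c_ℓ(E) ≤ ord₃ c_q(E)`» (ANY reduction type at `q`) inserted ⟹ Σ's conclusion, from `hPT`, `hF1`, `h372`
ONLY (no reading stub, no PUB, no `r_an`, no Manin, no twisted `L`). Carrier `q = 3`: `c₃(E) = 2` on a (t′) row (p824349 §1), so the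
depth is `0` and `3⁰ ∣ P_n` is free; carrier `q ≠ 3`: §1 (`d_K ≠ −3` since `3 ∣ N_E` splits, `d_K ≠ −4` since `d_K` is odd).
CONDITIONAL; closes nothing by name. [cite: Jetchev2008, Thm. 1.4 (p. 812)] [cite: GrossLMS1991, Prop. 3.7 (2), §6 p. 245]
[cite: SilvermanATAEC1994, IV.9.4 Steps 4 and 9 (PDF pp. 344–346)] -/
theorem sigmaIrreducibleOptimalRows_monoCarrier_onto_of_threePrintFacts
    (hPT : ∀ (K : Type) [Field K] [NumberField K], poitouTate_selmerStructure_duality_conj K)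
    (hF1 : Gross1991_heegnerPoint_sub_ratTorsion_mem_E0) (h372 : GrossLMS1991.prop37_2_frobeniusCongruence) :
    ∀ (W : WeierstrassCurve ℚ) [W.IsElliptic] [W.IsGloballyMinimal] [NeZero (W.conductorNorm ℤ)]
      (K : Type) [Field K] [NumberField K] (Dt : ModularParametrizationData W (W.conductorNorm ℤ))
      (H : HeegnerDatum (W.conductorNorm ℤ) (NumberField.discr K)) (ι : K →+* ℂ) (P : (W.baseChange K).toAffine.Point),
      ¬ W.HasCM → Addv W 3 → SubTprime W 3 → W.HasIrreducibleModPGaloisRep 3 → W.HasSurjectiveModNGaloisRep 3 →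
      W.analyticRank = 1 →
      ¬ (3 : ℤ) ∣ Dt.c → IsImaginaryQuadratic K → SatisfiesHeegnerHypothesis (W.conductorNorm ℤ) K →
      (W.quadraticTwist (NumberField.discr K : ℚ)).entireLFunction 1 ≠ 0 →
      WeierstrassCurve.Affine.Point.map ι.toRatAlgHom P = heegnerPointComplex Dt H → ¬ IsOfFinAddOrder P →
      Odd (NumberField.discr K) →
      (∃ (q : ℕ) (_ : Fact q.Prime), q ∣ W.conductorNorm ℤ ∧
        padicValNat 3 W.tamagawaProduct ≤ padicValNat 3 ((W.baseChange ℚ_[q]).localTamagawaNumber ℤ_[q])) →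
      ∀ (s' : ℕ), s' ≤ padicValNat 3 W.tamagawaProduct →
      ∀ (n : ℕ) (d : KolyvaginHeegnerData Dt H.β ι n), Squarefree n →
      (∀ ℓ ∈ n.primeFactors, Zhang2014.IsKolyvaginPrime (W.conductorNorm ℤ) W K 3 ℓ ∧
        s' ≤ Zhang2014.kolyvaginIndex W 3 ℓ) → Koly.PDiv d 3 s' := by
  intro W _ _ _ K _ _ Dt H ι P _ hadd hT _ hsurj _ _ hK hHN _ hP hnt hodd hrow s' hs' n d hn hℓ
  obtain ⟨q, hq, hqN, hmono⟩ := hrow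
  haveI : Fact (Nat.Prime 3) := ⟨Nat.prime_three⟩
  by_cases hq3 : q = 3
  · -- the carrier is `3` itself: `c₃(E) = 2` on a (t′) row, so the depth is `0`
    subst hq3
    have h0 : padicValNat 3 ((W.baseChange ℚ_[3]).localTamagawaNumber ℤ_[3]) = 0 := by
      rw [localTamagawaNumber_three_eq_two_of_subTprime W hadd hT]
      exact padicValNat.eq_zero_of_not_dvd (by norm_num)
    have hs0 : s' = 0 := by omega
    subst hs0
    exact Koly.pDiv_zero d 3
  · have h3N : 3 ∣ W.conductorNorm ℤ :=
      (W.dvd_conductorNorm_iff_not_hasGoodReductionAtPrime 3).mpr (not_good_of_addv W 3 hadd)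
    -- `d_K ∉ {-3, -4}`: `3 ∣ N_E` splits in `K`, `d_K` odd
    have h3 : NumberField.discr K ≠ -3 := by
      intro h
      exact (X11b.Three.not_dvd_discr_and_not_dvd_torsionOrder_of_heegner hK hHN (by decide) h3N).1
        (h ▸ ⟨-1, by norm_num⟩)
    have h4 : NumberField.discr K ≠ -4 := by
      intro h
      rw [h] at hodd
      exact (Int.not_odd_iff_even.mpr ⟨-2, by norm_num⟩) hodd
    exact pDiv_of_dvd_level_of_heegnerFrame_onto_of_threePrintFacts hPT hF1 h372 W K hK h3 h4 hHN 3 (by decide) hsurj Dt H ι P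
      hP hnt q hqN hq3 s' (hs'.trans hmono) n d hn hℓ

/-! ## §3 The typed upper half on the ONTO mono-carrier (t′) rows with a Manin-clean datum ⟸ PUB + three print facts + L₀ -/

/-- **`Typed.MissingUpperBoundAt W 3` ON A MONO-CARRIER (t′) ROW WITH `ρ̄₃` ONTO AND A MANIN-CLEAN DATUM ⟸ PUB + three print facts +
L₀.** Data: `W/ℚ` globally minimal, non-CM, additive of type (t′) at `3`, `ρ̄_{E,3}` onto, `r_an(W) = 1`; a prime `q ∣ N_E` (ANY
reduction type) with `ord₃ ∏_ℓ c_ℓ(E) ≤ ord₃ c_q(E)`; a datum `Dt` at level `N_E` with `3 ∤ c(Dt)`. DISPLAYED INPUTS: PUB (`hGZ hKo hGZK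
hmod hGZ73 hMN hnf hFH`), the three print facts `hPT hF1 h372`, and `hL0` = the non-CM (t′) rank-ZERO lower half at `3`. Proof = p823764's
`tprime_upper_three_of_irreducible_of_sigmaAtDatum_of_lowerRankZero` with Σ at `Dt` supplied by §2. CONDITIONAL; nothing asserted.
[cite: Jetchev2008, Thm. 1.4 (p. 812)] [cite: MatarNekovar2019, Thm. 0.7 (p. 456), §0.11] [cite: FriedbergHoffstein1995, Thm. B]
[cite: GrossZagier1986, Thm. I.(6.3), (7.3)] [cite: Miller2011LMS, Def. 1.1] -/
theorem tprime_upper_three_of_onto_carrier_of_threePrintFacts_of_lowerRankZero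
    (hGZ : ∀ (N : ℕ) [NeZero N] (W : WeierstrassCurve ℚ) (K : Type) [Field K] [NumberField K],
      gross_zagier N W K)
    (hKo : ∀ (N : ℕ) [NeZero N] (W : WeierstrassCurve ℚ) (K : Type) [Field K] [NumberField K],
      kolyvagin N W K)
    (hGZK : rank_eq_analyticRank_of_analyticRank_le_one) (hmod : hasEntireLFunction_rat)
    (hGZ73 : GrossZagier1986_thm_I_7_3)
    (hMN : MatarNekovar2019.thm07_padicValNat_card_sha_primary_add_le_of_globalDivisibility_of_irreducible)
    (hnf : exists_isNewformOf) (hFH : friedbergHoffstein_exists_heegnerField_splitDivisors_twist_ne_zero)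
    (hPT : ∀ (K : Type) [Field K] [NumberField K], poitouTate_selmerStructure_duality_conj K)
    (hF1 : Gross1991_heegnerPoint_sub_ratTorsion_mem_E0) (h372 : GrossLMS1991.prop37_2_frobeniusCongruence)
    (hL0 : ∀ (V : WeierstrassCurve ℚ) [V.IsElliptic] [V.IsGloballyMinimal],
      ¬ V.HasCM → Addv V 3 → SubTprime V 3 → V.analyticRank = 0 → MissingLowerBoundAt V 3)
    (W : WeierstrassCurve ℚ) [W.IsElliptic] [W.IsGloballyMinimal] [NeZero (W.conductorNorm ℤ)]
    (hCM : ¬ W.HasCM) (hadd : Addv W 3) (hT : SubTprime W 3) (hsurj : W.HasSurjectiveModNGaloisRep 3)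
    (hr : W.analyticRank = 1)
    (q : ℕ) [Fact q.Prime] (hqN : q ∣ W.conductorNorm ℤ)
    (hmono : padicValNat 3 W.tamagawaProduct ≤ padicValNat 3 ((W.baseChange ℚ_[q]).localTamagawaNumber ℤ_[q]))
    (Dt : ModularParametrizationData W (W.conductorNorm ℤ)) (hc : ¬ (3 : ℤ) ∣ Dt.c) :
    MissingUpperBoundAt W 3 := by
  have hirr : W.HasIrreducibleModPGaloisRep 3 := hasIrreducibleModPGaloisRep_of_hasSurjectiveModNGaloisRep W 3 hsurj
  have hc0 : padicValNat 3 Dt.c.natAbs = 0 :=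
    padicValNat.eq_zero_of_not_dvd fun h ↦ hc (Int.ofNat_dvd_left.mpr h)
  refine tprime_upper_three_of_irreducible_of_sigmaAtDatum_of_lowerRankZero hGZ hKo hGZK hmod hGZ73 hMN hnf hFH hL0
    W hCM hadd hT hirr hr Dt ?_
  intro K _ _ H ι P hK hHN hLt hP hnt hodd s' hs' n d hn hℓ
  exact sigmaIrreducibleOptimalRows_monoCarrier_onto_of_threePrintFacts hPT hF1 h372 W K Dt H ι P hCM hadd hT hirr hsurj hr hc
    hK hHN hLt hP hnt hodd ⟨q, inferInstance, hqN, hmono⟩ s' (by omega) n d hn hℓ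

/-! ## §4 In v1's r₁ binders (`ρ̄₃` onto): the mono-carrier rows ⟸ PUB + three print facts + KT 19981 -/

/-- **r₁ (`stub_ontoRowsOfManinUnit` of v1; the onto part of v2's Σ-side) ON THE MONO-CARRIER ROWS ⟸ PUB + three print facts + KT 19981,
by name.** For every non-CM (t′) rank-one `W` with `ρ̄_{E,3}` ONTO such that (ROW) some prime `q ∣ N_E` — multiplicative or additive —
carries the whole `3`-part of `∏_ℓ c_ℓ(E)`, and every datum `D` at level `N_E` with `3 ∤ c(D)`: `Typed.MissingUpperBoundAt W 3` follows
from the printed named facts {Gross–Zagier, Kolyvagin, GZK, GZ I.(7.3), Matar–Nekovář Thm. 0.7, newform, Friedberg–Hoffstein, Poitou–Tate,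
Gross §6 `E⁰`, Gross 3.7 (2)} and route KT's item `TameLowerHalfRankZero` (19981, BY NAME) — NO research input. What r₁ still owes: the onto
rows with ≥ 2 Tamagawa-`3` carriers (Σ⁺) and L₀. CONDITIONAL; closes nothing. [cite: Jetchev2008, Thm. 1.4 and Cor. 1.5 (p. 812)]
[cite: GrossLMS1991, Prop. 3.7 (2), §6] [cite: MatarNekovar2019, Thm. 0.7 (p. 456), §0.11 (p. 457)] [cite: Kato2004Asterisque, Thm. 17.4] -/
theorem ontoRows_monoCarrier_of_pub_of_threePrintFacts_of_tameLowerHalfRankZero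
    (hGZ : ∀ (N : ℕ) [NeZero N] (W : WeierstrassCurve ℚ) (K : Type) [Field K] [NumberField K],
      gross_zagier N W K)
    (hKo : ∀ (N : ℕ) [NeZero N] (W : WeierstrassCurve ℚ) (K : Type) [Field K] [NumberField K],
      kolyvagin N W K)
    (hGZK : rank_eq_analyticRank_of_analyticRank_le_one) (hGZ73 : GrossZagier1986_thm_I_7_3)
    (hMN : MatarNekovar2019.thm07_padicValNat_card_sha_primary_add_le_of_globalDivisibility_of_irreducible)
    (hnf : exists_isNewformOf) (hFH : friedbergHoffstein_exists_heegnerField_splitDivisors_twist_ne_zero)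
    (hPT : ∀ (K : Type) [Field K] [NumberField K], poitouTate_selmerStructure_duality_conj K)
    (hF1 : Gross1991_heegnerPoint_sub_ratTorsion_mem_E0) (h372 : GrossLMS1991.prop37_2_frobeniusCongruence)
    (hKT : KatoDescentTamePotSupersingular.TameLowerHalfRankZero) :
    ∀ (W : WeierstrassCurve ℚ) [W.IsElliptic] [W.IsGloballyMinimal] [NeZero (W.conductorNorm ℤ)],
      ¬ W.HasCM → Rank1Residual.Addv W 3 → Summit.BirchSwinnertonDyer.Rank1Residual.Additive.SubTprime W 3 →
      W.HasSurjectiveModNGaloisRep 3 → W.analyticRank = 1 →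
      (∃ (q : ℕ) (_ : Fact q.Prime), q ∣ W.conductorNorm ℤ ∧
        padicValNat 3 W.tamagawaProduct ≤ padicValNat 3 ((W.baseChange ℚ_[q]).localTamagawaNumber ℤ_[q])) →
      ∀ (D : ModularParametrizationData W (W.conductorNorm ℤ)), ¬ (3 : ℤ) ∣ D.maninConstant →
        Rank1Residual.Typed.MissingUpperBoundAt W 3 := by
  intro W _ _ _ hCM hadd hT hsurj hr hrow D hc
  obtain ⟨q, hq, hqN, hmono⟩ := hrow
  exact tprime_upper_three_of_onto_carrier_of_threePrintFacts_of_lowerRankZero hGZ hKo hGZK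
    (hasEntireLFunction_rat_of_exists_isNewformOf hnf) hGZ73 hMN hnf hFH hPT hF1 h372
    (tprimeLowerRankZero_three_of_tameLowerHalfRankZero hKT) W hCM hadd hT hsurj hr q hqN hmono D hc

end Summit.BirchSwinnertonDyer.BirchSwinnertonDyer.Theorems.TprimeHeegnerUpperOfManinUnit

end
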